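import Summits.AtomisticToContinuum.BoseEinsteinCondensation.Theorems.BlockLatticeFSumBlockCondensationCellNEngine
import Summits.AtomisticToContinuum.BoseEinsteinCondensation.Theorems.BlockLatticeFSumBlockCondensationFloorBudget
import HarnessLib

/-!
# `BlockCondensation` (stmt-AtomisticToContinuum-13595), P3: `F♭₊ ⟸ CellNEngine`
# (decomp-a2c · hand-1 g9; memo `CARRIER-CHANGE-13595-P1.md` §3)

The positive-scattering-length half `CellNBudgetBlockFloorPos` (F♭₊) of the boundary-condition-free
block floor beneath `BlockCondensation` follows from the cellN-carrier engine `CellNEngine` (P1's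
target, the deterministic budget-form floor inequality `natCast_le_sum_occupation_add_budget`
re-typed over a `C¹` Bose-symmetric `ψ` normalised on `[0,L)^{3N}`) by the parameter block of the
tree's Dirichlet theorem `floor_of_scatteringLength_pos_sharp` (`BoseGasSubcellCondensationSharp.lean`)
run BOX-UNIFORMLY: density `ρ := N/L³ ≤ ρ₀`, scale `s := L/K` in the GP window
`A/√ρ ≤ s ≤ 2A/√ρ`, NO Dyson upper bound (`C_u := 0`: the budget `(4πa + τ)ρN` is a hypothesis of
F♭), slack `τ := min (4πa) (η/(16 C₄ A²))` (so that `8C₄A²τ ≤ η/2` and `τ ≤ 4πa`) — with the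
proportional slack the only particle threshold of the Dirichlet proof disappears
(`floorBudget_le_of_slack`), so `N₀ = 1`.  Cell classification, `good`/low/high bookkeeping,
LSSY Lemma 5.2 per good cell (`locLowerBound_neumann`), Thm 2.4 Neumann + superadditivity per high
cell, Lemma 4.1 (`LSSY2005_lemma41_holds`), `occupation_bookkeeping`, `floorParams_eventually`,
`floorBudgetSum_eventually_le` are used verbatim from the tree.
Main theorem: `cellNBudgetBlockFloorPos_of_engine : CellNEngine → CellNBudgetBlockFloorPos`.
No definitions, no `sorry`.
-/

noncomputable section

open MeasureTheory Filter Set Metric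
open scoped ENNReal NNReal Topology BigOperators

namespace Summit.AtomisticToContinuum.BoseEinsteinCondensation.Theorems.BlockCondensationFloorPos

open Literature.MathematicalPhysics.QuantumManyBody.BoseGas
open BlockCondensationCellNEngine (CellNEngine CellNBudgetBlockFloorPos)

/-- `(L/K)`-bookkeeping: with `s = L/K` and `ρ = N/L³`, `N/K³ = ρ s³`. [folklore] -/
theorem div_cube_eq_rho_mul_cube {N L s : ℝ} {K : ℕ} (hK : 0 < K) (hL : 0 < L)
    (hKs : (K : ℝ) * s = L) :
    N / (((K ^ 3 : ℕ) : ℝ)) = N / L ^ 3 * s ^ 3 := by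
  have hKr : (0 : ℝ) < K := by exact_mod_cast hK
  have hs : s ≠ 0 := by
    rintro rfl
    rw [mul_zero] at hKs
    linarith
  subst hKs
  push_cast
  field_simp

/-- The last step of the floor inequality: `N ≤ S + b` in `ℝ≥0∞` with a budget `b ≤ ηN`,
`η ≥ 0`, gives `(1-η)N ≤ S`. [folklore] -/
theorem ofReal_sub_le_of_natCast_le {n : ℕ} {S : ℝ≥0∞} {b η : ℝ} (hη0 : 0 ≤ η)
    (hmain : ((n + 1 : ℕ) : ℝ≥0∞) ≤ S + ENNReal.ofReal b) (hbudget : b ≤ η * ((n : ℝ) + 1)) :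
    ENNReal.ofReal ((1 - η) * ((n : ℝ) + 1)) ≤ S := by
  have hN : (0 : ℝ) ≤ (n : ℝ) + 1 := (Nat.cast_add_one_pos n).le
  rcases le_or_gt 1 η with hη1 | hη1
  · rw [ENNReal.ofReal_of_nonpos (mul_nonpos_of_nonpos_of_nonneg (by linarith) hN)]
    exact bot_le
  have hsplit : ((n + 1 : ℕ) : ℝ≥0∞) =
      ENNReal.ofReal ((1 - η) * ((n : ℝ) + 1)) + ENNReal.ofReal (η * ((n : ℝ) + 1)) := by
    rw [← ENNReal.ofReal_add (mul_nonneg (by linarith) hN) (mul_nonneg hη0 hN),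
      ← ENNReal.ofReal_natCast]
    congr 1; push_cast; ring
  have hfin : ENNReal.ofReal ((1 - η) * ((n : ℝ) + 1)) + ENNReal.ofReal (η * ((n : ℝ) + 1)) ≤
      S + ENNReal.ofReal (η * ((n : ℝ) + 1)) := by
    rw [← hsplit]
    exact hmain.trans (add_le_add le_rfl (ENNReal.ofReal_le_ofReal hbudget))
  exact (ENNReal.add_le_add_iff_right ENNReal.ofReal_ne_top).1 hfin
set_option maxHeartbeats 400000 in
/-- **P3: `F♭₊ ⟸ CellNEngine`.**  For a repulsive finite-range `v` with positive scattering length,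
every `A > 0` and `η > 0` there are `ρ₀ > 0`, `τ > 0` (and `N₀ = 1`) such that, box-uniformly in
`(N, L)` with `N ≥ 1`, `N ≤ ρ₀L³`, every `C¹` Bose-symmetric `ψ` normalised on `[0,L)^{3N}` with plain
cell energy `≤ (4πa + τ)(N/L³)N` has `∑_q ⟨u_q, γ u_q⟩ ≥ (1-η)N` over the sub-cells of side `L/K`
for every even `K > 0` in the GP window `A/√ρ ≤ L/K ≤ 2A/√ρ` — GIVEN the cellN-carrier engine.
The proof is the parameter block of `floor_of_scatteringLength_pos_sharp` with `ρ := N/L³`,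
`C_u := 0`, `s := L/K`, slack `τ := min (4πa) (η/(16C₄A²))`, and `floorBudget_le_of_slack` in place
of `floorBudget_le_of_le`. [cite: LSSY2005, Thm. 5.1 (5.15)–(5.17), Lemma 5.2 (5.7)–(5.14)] -/
theorem cellNBudgetBlockFloorPos_of_engine (hEng : CellNEngine) : CellNBudgetBlockFloorPos := by
  intro v hv hapos M hM η hη
  obtain ⟨R₀, hR₀⟩ := hv.2
  have hfin : scatteringLength v ≠ ⊤ := scatteringLength_ne_top_of_finiteRange hR₀
  set a : ℝ := (scatteringLength v).toReal with ha_def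
  have ha : 0 < a := ENNReal.toReal_pos hapos.ne' hfin
  obtain ⟨δ₁, C₁, hδ₁, hC₁, Hloc⟩ := locLowerBound_neumann v hv
  obtain ⟨δ₂, C₂, C₂', hδ₂, hC₂, hC₂', HLY⟩ := LSSY2005_lowerBound_neumann_holds v hv hfin
  obtain ⟨C₄, hC₄, H41⟩ := LSSY2005_lemma41_holds
  obtain ⟨ρp, hρp, Hpar⟩ := floorParams_eventually (C₁ := C₁) (C₂ := C₂) (C₂' := C₂') (C₄ := C₄)
    (Cu := 0) ha hM hδ₁ hδ₂
  obtain ⟨ρb, hρb, Hbud⟩ := floorBudgetSum_eventually_le (C₁ := C₁) (C₄ := C₄) (Cu := 0) ha hM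
    (half_pos hη)
  -- the slack
  set τ : ℝ := min (4 * Real.pi * a) (η / (16 * C₄ * M ^ 2)) with hτ_def
  have hτ : 0 < τ := lt_min (by positivity) (by positivity)
  have hτ1 : τ ≤ 4 * Real.pi * a := min_le_left _ _
  have hτ2 : τ ≤ η / (16 * C₄ * M ^ 2) := min_le_right _ _
  have hτ3 : 8 * C₄ * M ^ 2 * τ ≤ η / 2 := by
    have h16 : (0 : ℝ) < 16 * C₄ * M ^ 2 := by positivity
    have h1 : 8 * C₄ * M ^ 2 * τ ≤ 8 * C₄ * M ^ 2 * (η / (16 * C₄ * M ^ 2)) :=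
      mul_le_mul_of_nonneg_left hτ2 (by positivity)
    have h2 : 8 * C₄ * M ^ 2 * (η / (16 * C₄ * M ^ 2)) = η / 2 := by
      field_simp
      ring
    linarith
  refine ⟨min ρp ρb / 2, by positivity, τ, hτ, 1, ?_⟩
  intro N L hL _hN1 hNL ψ hψ hsymm hnorm hE K _hKev hK hwin
  obtain ⟨n, rfl⟩ : ∃ n, N = n + 1 := ⟨N - 1, by omega⟩
  -- the density of the box (a plain variable, not a `let`, to keep `isDefEq` cheap)
  obtain ⟨ρ, hρ_def⟩ : ∃ ρ : ℝ, ρ = ((n + 1 : ℕ) : ℝ) / L ^ 3 := ⟨_, rfl⟩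
  rw [← hρ_def] at hE hwin
  have hL3 : 0 < L ^ 3 := by positivity
  have hρ : 0 < ρ := by rw [hρ_def]; positivity
  have hρle : ρ ≤ min ρp ρb / 2 := by rw [hρ_def, div_le_iff₀ hL3]; exact hNL
  have hρp' : ρ < ρp := by
    have : min ρp ρb / 2 < ρp := by
      have := min_le_left ρp ρb; linarith
    linarith
  have hρb' : ρ < ρb := by
    have : min ρp ρb / 2 < ρb := by
      have := min_le_right ρp ρb; linarith
    linarith
  obtain ⟨hρ1, hYδ₁, hYδ₂, hy12, hθ12, hC2y, hbox, hpen, -, -⟩ := Hpar ρ hρ hρp'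
  have hbud := Hbud ρ hρ hρb'
  have hsr : 0 < Real.sqrt ρ := Real.sqrt_pos.2 hρ
  obtain ⟨hmth1, hmth2, hmth3⟩ := ceil_inv_bounds hρ hρ1
  set mth : ℕ := ⌈ρ⁻¹⌉₊ with hmth_def
  have hmthr : (0 : ℝ) < mth := by exact_mod_cast hmth3
  -- density-only quantities
  set Ymax : ℝ := 8 * Real.pi * a ^ 3 * Real.sqrt ρ / (3 * M ^ 3) with hYmax
  set θ : ℝ := C₁ * Ymax ^ ((1 : ℝ) / 17) with hθ_def
  have hθ0 : 0 ≤ θ := by positivity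
  set lambar : ℝ := (6 * M ^ 3 / (Real.pi * a ^ 3 * (ρ * Real.sqrt ρ))) ^ ((1 : ℝ) / 18) with hlambar
  set wbar : ℝ := ((Real.pi * 4 / 3) * a ^ 3 *
    (Real.pi * a ^ 3 * (ρ * Real.sqrt ρ) / (6 * M ^ 3)) ^ (-(15 : ℝ) / 17) *
      (2 / ρ) ^ ((2 : ℝ) / 17)) ^ ((2 : ℝ) / 3) with hwbar
  -- the scale (a plain variable as well)
  obtain ⟨s, hs_def⟩ : ∃ s : ℝ, s = L / (K : ℝ) := ⟨_, rfl⟩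
  rw [← hs_def] at hwin ⊢
  have hKr : (0 : ℝ) < K := by exact_mod_cast hK
  have hs : 0 < s := by rw [hs_def]; exact div_pos hL hKr
  have hsl : M / Real.sqrt ρ ≤ s := hwin.1
  have hsu : s ≤ 2 * M / Real.sqrt ρ := hwin.2
  have hKs : (K : ℝ) * s = L := by rw [hs_def]; field_simp
  have hKc : (0 : ℝ) < (((K ^ 3 : ℕ) : ℝ)) := by positivity
  have hKN : (((n + 1 : ℕ) : ℝ)) / (((K ^ 3 : ℕ) : ℝ)) = ρ * s ^ 3 := by
    rw [hρ_def]; exact div_cube_eq_rho_mul_cube hK hL hKs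
  -- cell quantities
  set Yc : ℕ → ℝ := fun m => 4 * Real.pi * ((m : ℝ) / s ^ 3) * a ^ 3 / 3 with hYc
  have hYc0 : ∀ m, 0 ≤ Yc m := fun m => by rw [hYc]; positivity
  set good : ℕ → Prop := fun m => Yc m ^ (-(1 : ℝ) / 17) ≤ m ∧ (m : ℝ) ≤ mth with hgood
  set yf : ℕ → ℝ := fun m => Yc m ^ ((1 : ℝ) / 17) with hyf
  set Rf : ℕ → ℝ := fun m => a * Yc m ^ (-(5 : ℝ) / 17) with hRf
  set LYval : ℝ := 4 * Real.pi * ((mth : ℝ) / s ^ 3) * a * (1 - C₂ * Yc mth ^ ((1 : ℝ) / 17)) * mth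
    with hLYval
  set lb : ℕ → ℝ := fun m => if good m then 4 * Real.pi * ((m : ℝ) / s ^ 3) * a * (1 - C₁ * yf m) * m
    else if (m : ℝ) ≤ mth then 0 else ((m / mth : ℕ) : ℝ) * LYval with hlb
  set lam : ℝ := (3 * s ^ 3 / (4 * Real.pi * a ^ 3)) ^ ((1 : ℝ) / 18) with hlam
  set w : ℝ := ((Real.pi * 4 / 3) * a ^ 3 * (4 * Real.pi * a ^ 3 / (3 * s ^ 3)) ^ (-(15 : ℝ) / 17) *
    (mth : ℝ) ^ ((2 : ℝ) / 17)) ^ ((2 : ℝ) / 3) with hw_def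
  set κ : ℝ := 1 / (2 * C₄ * s ^ 2) with hκ_def
  set Ur : ℝ := (4 * Real.pi * a + τ) * ρ * ((n : ℝ) + 1) with hUr
  set A : ℝ := (1 - θ) * (4 * Real.pi * a / s ^ 3) * (((n + 1 : ℕ) : ℝ)) ^ 2 / (((K ^ 3 : ℕ) : ℝ))
    with hA_def
  set B : ℝ := (((K ^ 3 : ℕ) : ℝ)) * lam *
    ((1 - θ) * (8 * Real.pi * a / s ^ 3) * ((((n + 1 : ℕ) : ℝ)) / (((K ^ 3 : ℕ) : ℝ))) + κ) with hB_def
  -- density bounds for good cells and at the threshold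
  have hYmax_bd : ∀ m : ℕ, (m : ℝ) ≤ mth → Yc m ≤ Ymax := fun m hm =>
    cellY_le_Ymax ha hM hρ hsl hm hmth2
  have hYmin_bd : Real.pi * a ^ 3 * Real.sqrt ρ / (6 * M ^ 3) ≤ Yc mth :=
    Ymin_le_cellY ha hM hρ hsu hs hmth1
  have hθm : ∀ m : ℕ, (m : ℝ) ≤ mth → C₁ * yf m ≤ θ := fun m hm => by
    rw [hyf, hθ_def]
    exact mul_le_mul_of_nonneg_left (Real.rpow_le_rpow (hYc0 m) (hYmax_bd m hm) (by norm_num)) hC₁.le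
  have hθ1 : θ ≤ 1 / 2 := hθ12
  have hC2m : C₂ * Yc mth ^ ((1 : ℝ) / 17) ≤ 1 / 2 :=
    le_trans (mul_le_mul_of_nonneg_left (Real.rpow_le_rpow (hYc0 mth) (hYmax_bd mth le_rfl)
      (by norm_num)) hC₂.le) hC2y
  have hLYval : 2 * Real.pi * a * (mth : ℝ) ^ 2 / s ^ 3 ≤ LYval := by
    rw [hLYval]
    have h1 : (1 : ℝ) / 2 ≤ 1 - C₂ * Yc mth ^ ((1 : ℝ) / 17) := by linarith
    calc 2 * Real.pi * a * (mth : ℝ) ^ 2 / s ^ 3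
        = 4 * Real.pi * ((mth : ℝ) / s ^ 3) * a * (1 / 2) * mth := by field_simp; ring
      _ ≤ 4 * Real.pi * ((mth : ℝ) / s ^ 3) * a * (1 - C₂ * Yc mth ^ ((1 : ℝ) / 17)) * mth := by
          gcongr
  ----------------------------------------------------------------
  -- the hypotheses of the deterministic floor inequality
  ----------------------------------------------------------------
  have hW : ∀ m' : ℕ, good (m' + 1) →
      ((m' : ℝ≥0∞) * (ENNReal.ofReal (Rf (m' + 1)) ^ 3 * ENNReal.ofReal (Real.pi * 4 / 3))) ^
        (2 / 3 : ℝ) ≤ ENNReal.ofReal w := by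
    intro m' hg
    have hm : (m' : ℝ) + 1 ≤ mth := by have := hg.2; push_cast at this; exact this
    have h := excludedVolume_rpow_le (s := s) ha hs hm
    rw [hw_def, hRf]
    exact h
  have hy : ∀ m, good m → 0 ≤ yf m ∧ yf m ≤ 1 / 2 := by
    intro m hg
    refine ⟨Real.rpow_nonneg (hYc0 m) _, ?_⟩
    exact le_trans (Real.rpow_le_rpow (hYc0 m) (hYmax_bd m hg.2) (by norm_num)) hy12
  have hloc : ∀ m, good m → ENNReal.ofReal (lb m) ≤ locGroundStateEnergy (yf m) (Rf m) v m s := by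
    intro m hg
    have hlbm : lb m = 4 * Real.pi * ((m : ℝ) / s ^ 3) * a * (1 - C₁ * yf m) * m := by
      rw [hlb]; simp only [hg, if_true]
    rw [hlbm]
    rcases Nat.eq_zero_or_pos m with rfl | hmpos
    · simp
    have hY1 : Yc m < δ₁ := lt_of_le_of_lt (hYmax_bd m hg.2) hYδ₁
    have hY2 : Yc m ^ (-(6 : ℝ) / 17) < s / a := rpow_lt_div_of_le hmpos hs ha hg.1
    exact Hloc m s hs hY1 hY2
  have hE0 : ∀ m, ¬ good m → ENNReal.ofReal (lb m) ≤ neumannGroundStateEnergy v m s := by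
    intro m hg
    by_cases hm : (m : ℝ) ≤ mth
    · have : lb m = 0 := by rw [hlb]; simp only [hg, if_false, hm, if_true]
      rw [this, ENNReal.ofReal_zero]; exact bot_le
    · have hlbm : lb m = ((m / mth : ℕ) : ℝ) * LYval := by
        rw [hlb]; simp only [hg, if_false, hm]
      rw [hlbm, ENNReal.ofReal_mul (Nat.cast_nonneg _), ENNReal.ofReal_natCast]
      -- the Lieb–Yngvason bound in the cell at the threshold occupation
      have hY1 : Yc mth < δ₂ := lt_of_le_of_lt (hYmax_bd mth le_rfl) hYδ₂
      have hY2 : C₂' * Yc mth ^ (-(6 : ℝ) / 17) < s / a := by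
        have h1 : Yc mth ^ (-(6 : ℝ) / 17) ≤
            (Real.pi * a ^ 3 * Real.sqrt ρ / (6 * M ^ 3)) ^ (-(6 : ℝ) / 17) :=
          Real.rpow_le_rpow_of_nonpos (by positivity) hYmin_bd (by norm_num)
        have h2 : M / (a * Real.sqrt ρ) ≤ s / a := by
          rw [div_le_div_iff₀ (by positivity) ha]
          have h3 : M ≤ s * Real.sqrt ρ := (div_le_iff₀ hsr).1 hsl
          calc M * a ≤ s * Real.sqrt ρ * a := by gcongr
            _ = s * (a * Real.sqrt ρ) := by ring
        exact lt_of_le_of_lt (mul_le_mul_of_nonneg_left h1 hC₂'.le) (hbox.trans_le h2)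
      have hLY : ENNReal.ofReal LYval ≤ neumannGroundStateEnergy v mth s := HLY mth s hs hY1 hY2
      have hsup := LSSY2005_superadditivity_holds.mul_le hv.1 hs mth (m / mth) (m % mth)
      rw [Nat.div_add_mod'] at hsup
      exact le_trans (mul_le_mul_right hLY _) hsup
  -- the occupation bookkeeping
  have hκcond : κ + (1 - θ) * (8 * Real.pi * a / s ^ 3) *
      ((((n + 1 : ℕ) : ℝ)) / (((K ^ 3 : ℕ) : ℝ))) ≤ Real.pi * a * mth / s ^ 3 := by
    rw [hKN, hκ_def]
    exact kappa_condition ha hM hρ hC₄ hsl hsu hθ0 hmth1 hpen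
  have hcomb : ∀ nv : Fin (K ^ 3) → ℕ, ∑ c, nv c = n + 1 →
      ENNReal.ofReal A + ENNReal.ofReal κ * ∑ c, (if good (nv c) then 0 else (nv c : ℝ≥0∞)) ≤
        (∑ c, ENNReal.ofReal (lb (nv c))) + ENNReal.ofReal B := by
    intro nv hsum
    rw [hA_def, hB_def]
    refine occupation_bookkeeping (mth := mth) good lb (lam := lam) (κh := Real.pi * a * mth / s ^ 3)
      hs ha.le (by linarith) (by positivity) (by positivity) ?_ ?_ ?_ hκcond nv hsum
    · -- good cells
      intro m hg
      have hlbm : lb m = 4 * Real.pi * ((m : ℝ) / s ^ 3) * a * (1 - C₁ * yf m) * m := by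
        rw [hlb]; simp only [hg, if_true]
      rw [hlbm]
      have h1 : C₁ * yf m ≤ θ := hθm m hg.2
      have h2 : 0 ≤ 4 * Real.pi * a / s ^ 3 * (m : ℝ) ^ 2 := by positivity
      calc (1 - θ) * (4 * Real.pi * a / s ^ 3) * (m : ℝ) ^ 2
          = (1 - θ) * (4 * Real.pi * a / s ^ 3 * (m : ℝ) ^ 2) := by ring
        _ ≤ (1 - C₁ * yf m) * (4 * Real.pi * a / s ^ 3 * (m : ℝ) ^ 2) :=
            mul_le_mul_of_nonneg_right (by linarith) h2
        _ = _ := by ring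
    · -- low cells
      intro m hg hm
      have hlbm : lb m = 0 := by rw [hlb]; simp only [hg, if_false, hm, if_true]
      refine ⟨hlbm.ge, ?_⟩
      have hng : ¬ (Yc m ^ (-(1 : ℝ) / 17) ≤ m) := fun h => hg ⟨h, hm⟩
      exact (lt_lam_of_not_rpow_le ha hs hng).2.le
    · -- high cells
      intro m hg hm
      have hm' : ¬ ((m : ℝ) ≤ mth) := not_le.2 hm
      have hlbm : lb m = ((m / mth : ℕ) : ℝ) * LYval := by rw [hlb]; simp only [hg, if_false, hm']
      rw [hlbm]
      have hmn : mth < m := by exact_mod_cast hm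
      have hq := div_two_mul_le_nat_div hmth3 hmn
      calc Real.pi * a * mth / s ^ 3 * m = (m : ℝ) / (2 * mth) * (2 * Real.pi * a * (mth : ℝ) ^ 2 / s ^ 3) := by
            field_simp
        _ ≤ ((m / mth : ℕ) : ℝ) * LYval := mul_le_mul hq hLYval (by positivity) (Nat.cast_nonneg _)
  have hκ1 : 1 ≤ 2 * C₄ * s ^ 2 * κ := by
    rw [hκ_def, show 2 * C₄ * s ^ 2 * (1 / (2 * C₄ * s ^ 2)) = 1 by field_simp]
  have hUr' : Ur = (4 * Real.pi * a + τ) * ρ * ((n + 1 : ℕ) : ℝ) := by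
    rw [hUr]; norm_cast
  have hE' : ∫⁻ X in cellN (n + 1) L, kineticDensity ψ X + interaction v X * (‖ψ X‖₊ : ℝ≥0∞) ^ 2 ≤
      ENNReal.ofReal Ur := by
    rw [hUr']; exact hE
  have hA_eq : A = (1 - θ) * 4 * Real.pi * a * ρ * ((n : ℝ) + 1) := by
    rw [hA_def]
    have h1 : (((n + 1 : ℕ) : ℝ)) ^ 2 / (((K ^ 3 : ℕ) : ℝ)) =
        ((n + 1 : ℕ) : ℝ) * ((((n + 1 : ℕ) : ℝ)) / (((K ^ 3 : ℕ) : ℝ))) := by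
      rw [pow_two, mul_div_assoc]
    rw [mul_div_assoc, h1, hKN]
    push_cast
    field_simp
  have hlam0 : 0 ≤ lam := by rw [hlam]; positivity
  have hB0 : 0 ≤ B := by
    rw [hB_def]
    exact mul_nonneg (mul_nonneg (Nat.cast_nonneg _) hlam0) (add_nonneg (mul_nonneg
      (mul_nonneg (by linarith) (by positivity)) (by positivity)) (by rw [hκ_def]; positivity))
  have hUBA : A ≤ Ur + B := by
    have hP : 0 ≤ 4 * Real.pi * ρ * a * ((n : ℝ) + 1) := by positivity
    calc A = (1 - θ) * (4 * Real.pi * ρ * a * ((n : ℝ) + 1)) := by rw [hA_eq]; ring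
      _ ≤ 1 * (4 * Real.pi * ρ * a * ((n : ℝ) + 1)) :=
          mul_le_mul_of_nonneg_right (by linarith) hP
      _ ≤ Ur := by
          rw [hUr, one_mul]
          have h0 : 0 ≤ τ * ρ * ((n : ℝ) + 1) := by positivity
          have h1 : (4 * Real.pi * a + τ) * ρ * ((n : ℝ) + 1) =
              4 * Real.pi * ρ * a * ((n : ℝ) + 1) + τ * ρ * ((n : ℝ) + 1) := by ring
          linarith
      _ ≤ Ur + B := le_add_of_nonneg_right hB0
  have hbudget : 2 * C₄ * s ^ 2 * (Ur + B - A) + C₄ * w * Ur ≤ η * ((n : ℝ) + 1) := by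
    have hlamle : lam ≤ lambar := lam_le_lambar ha hM hρ hsu hs
    have hwle : w ≤ wbar := w_le_wbar ha hM hρ hsu hs hmthr hmth2
    have hw0 : 0 ≤ w := by rw [hw_def]; positivity
    have hpar : 8 * C₄ * M ^ 2 * τ + (32 * Real.pi * C₄ * M ^ 2 * a * θ +
        16 * Real.pi * C₄ * a * lambar * Real.sqrt ρ / M + lambar * Real.sqrt ρ / M ^ 3 +
          8 * Real.pi * C₄ * a * ρ * wbar) ≤ η := by
      have hb : 32 * Real.pi * C₄ * M ^ 2 * a * θ +
          16 * Real.pi * C₄ * a * lambar * Real.sqrt ρ / M + lambar * Real.sqrt ρ / M ^ 3 +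
            8 * Real.pi * C₄ * a * ρ * wbar ≤ η / 2 := by
        have h0 : 32 * Real.pi * C₄ * M ^ 2 * a * (0 * (ρ * a ^ 3) ^ ((1 : ℝ) / 3) + θ) =
            32 * Real.pi * C₄ * M ^ 2 * a * θ := by ring
        linarith [hbud, h0]
      linarith
    have hKN' : ((n : ℝ) + 1) / (((K ^ 3 : ℕ) : ℝ)) = ρ * s ^ 3 := by
      rw [← hKN]; norm_cast
    have h := floorBudget_le_of_slack (lam := lam) (w := w) (N := (n : ℝ) + 1)
      (K := (((K ^ 3 : ℕ) : ℝ))) hM ha hC₄ hτ.le hτ1 hρ hsl hsu hθ0 le_rfl hlam0 hlamle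
      hw0 hwle (by positivity) hKc hKN' hpar
    rw [hUr, hB_def, hA_def]
    push_cast at h ⊢
    exact h
  ----------------------------------------------------------------
  -- the engine
  ----------------------------------------------------------------
  have hw0 : 0 ≤ w := by rw [hw_def]; positivity
  have hUr0 : 0 ≤ Ur := by rw [hUr]; positivity
  have hA0 : 0 ≤ A := by
    rw [hA_eq]
    have : 0 ≤ 1 - θ := by linarith
    positivity
  have hmain := hEng n K s L hs hK hKs hL v hv.1 ψ hψ hsymm hnorm good Rf yf lb C₄ w Ur A B κ
    hC₄.le hw0 hUr0 hA0 hB0 H41 hW hy hloc hE0 hcomb hκ1 hE' hUBA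
  -- conclude: split `N = (1-η)N + ηN` and cancel the budget
  push_cast
  exact ofReal_sub_le_of_natCast_le hη.le hmain hbudget

end Summit.AtomisticToContinuum.BoseEinsteinCondensation.Theorems.BlockCondensationFloorPos

end
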